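import Mathlib
import Literature.Combinatorics.Additive.TripleProductProperty

/-!
# `SnSubsetDichotomy.ThresholdSubsetTriples`, line `SketchIdeator2` — stub `tpp_conj_iff_corner`

The torsion-free triality lever of the ℤ/3-symmetric line of crux
`stmt-MatrixMultiplication-10882` (registered stub `tpp_conj_iff_corner`): for *every* element `γ`
of a group and every finite set `X`, the conjugate triple `(X, γXγ⁻¹, γ²Xγ⁻²)` has the triple
product property (`Literature.Combinatorics.Additive.TripleProductProperty`, Cohn–Umans 2003,
Def. 2.1) **if and only if** the *twisted corner* equation
`a a'⁻¹ · γ · b b'⁻¹ · γ · c c'⁻¹ · γ = γ³` has only the trivial solutions `a = a'`, `b = b'`,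
`c = c'` in `X`.

Proof: for `t = γbγ⁻¹`, `t' = γb'γ⁻¹`, `u = γ²cγ⁻²`, `u' = γ²c'γ⁻²` one has the group identity
`a a'⁻¹ · γ (b b'⁻¹) γ (c c'⁻¹) γ = (a a'⁻¹ · t t'⁻¹ · u u'⁻¹) · γ³`, so the TPP relations of the
conjugate triple are exactly the twisted corners of `X`, and conjugation by `γ`, `γ²` is injective.
With `γ³ = 1` this recovers the landed lever `stub_tpp_of_twistFree`
(`SnSubsetDichotomyThresholdSubsetTriplesStubTppOfTwistFree.lean`).
-/

namespace Summit.MatrixMultiplication.MatrixMultiplication.Theorems.ThresholdSubsetTriples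

open Literature.Combinatorics.Additive

-- `Summit.<Summit>.<Problem>` is the tree's mandated summit-side namespace; for this single-conjunct
-- summit the two coincide (`MatrixMultiplication.MatrixMultiplication`), so the declaration
-- silences `dupNamespace`, as in the landed siblings `SnSubsetDichotomy*Stub*.lean`.

-- adapted from SnSubsetDichotomyThresholdSubsetTriplesStubTppOfTwistFree.lean (tpp_of_twist)
set_option linter.dupNamespace false in -- deliberate `Summit.<S>.<P>` duplicate
/-- **Stub `tpp_conj_iff_corner` (the triality lever, torsion-free form)** (line `SketchIdeator2`
of crux `SnSubsetDichotomy.ThresholdSubsetTriples`, stmt-MatrixMultiplication-10882).  For every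
`γ` in a group `G` and every finite `X ⊆ G`, the conjugate triple `(X, γXγ⁻¹, γ²Xγ⁻²)` has the
triple product property iff the twisted corner equation `a a'⁻¹ γ (b b'⁻¹) γ (c c'⁻¹) γ = γ³` has
only the trivial solutions `a = a'`, `b = b'`, `c = c'` in `X`: a TPP relation
`s s'⁻¹ (t t'⁻¹) (u u'⁻¹) = 1` with `t, t' ∈ γXγ⁻¹`, `u, u' ∈ γ²Xγ⁻²` is, after multiplying by
`γ³` on the right, a twisted corner of `X`, and conjugation is injective. [folklore] -/
theorem tpp_conj_iff_corner {G : Type*} [Group G] [DecidableEq G] (X : Finset G) (γ : G) :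
    TripleProductProperty X (X.image (fun x => γ * x * γ⁻¹))
      (X.image (fun x => γ ^ 2 * x * (γ ^ 2)⁻¹)) ↔
    ∀ a ∈ X, ∀ a' ∈ X, ∀ b ∈ X, ∀ b' ∈ X, ∀ c ∈ X, ∀ c' ∈ X,
      a * a'⁻¹ * γ * (b * b'⁻¹) * γ * (c * c'⁻¹) * γ = γ ^ 3 → a = a' ∧ b = b' ∧ c = c' := by
  constructor
  · -- (→): a twisted corner of `X` is, up to the factor `(γ³)⁻¹`, a TPP relation of the triple
    intro h a ha a' ha' b hb b' hb' c hc c' hc' hw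
    have key : a * a'⁻¹ * (γ * b * γ⁻¹ * (γ * b' * γ⁻¹)⁻¹) *
        (γ ^ 2 * c * (γ ^ 2)⁻¹ * (γ ^ 2 * c' * (γ ^ 2)⁻¹)⁻¹) = 1 := by
      calc a * a'⁻¹ * (γ * b * γ⁻¹ * (γ * b' * γ⁻¹)⁻¹) *
            (γ ^ 2 * c * (γ ^ 2)⁻¹ * (γ ^ 2 * c' * (γ ^ 2)⁻¹)⁻¹)
          = (a * a'⁻¹ * γ * (b * b'⁻¹) * γ * (c * c'⁻¹) * γ) * (γ ^ 3)⁻¹ := by group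
        _ = 1 := by rw [hw, mul_inv_cancel]
    obtain ⟨h1, h2, h3⟩ := h a ha a' ha'
      (γ * b * γ⁻¹) (Finset.mem_image_of_mem (fun x => γ * x * γ⁻¹) hb)
      (γ * b' * γ⁻¹) (Finset.mem_image_of_mem (fun x => γ * x * γ⁻¹) hb')
      (γ ^ 2 * c * (γ ^ 2)⁻¹) (Finset.mem_image_of_mem (fun x => γ ^ 2 * x * (γ ^ 2)⁻¹) hc)
      (γ ^ 2 * c' * (γ ^ 2)⁻¹) (Finset.mem_image_of_mem (fun x => γ ^ 2 * x * (γ ^ 2)⁻¹) hc')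
      key
    exact ⟨h1, mul_left_cancel (mul_right_cancel h2), mul_left_cancel (mul_right_cancel h3)⟩
  · -- (←): a TPP relation of the triple is, up to the factor `γ³`, a twisted corner of `X`
    intro htw s hs s' hs' t ht t' ht' u hu u' hu' hprod
    obtain ⟨b, hb, rfl⟩ := Finset.mem_image.mp ht
    obtain ⟨b', hb', rfl⟩ := Finset.mem_image.mp ht'
    obtain ⟨c, hc, rfl⟩ := Finset.mem_image.mp hu
    obtain ⟨c', hc', rfl⟩ := Finset.mem_image.mp hu'
    have key : s * s'⁻¹ * γ * (b * b'⁻¹) * γ * (c * c'⁻¹) * γ = γ ^ 3 := by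
      calc s * s'⁻¹ * γ * (b * b'⁻¹) * γ * (c * c'⁻¹) * γ
          = (s * s'⁻¹ * (γ * b * γ⁻¹ * (γ * b' * γ⁻¹)⁻¹) *
              (γ ^ 2 * c * (γ ^ 2)⁻¹ * (γ ^ 2 * c' * (γ ^ 2)⁻¹)⁻¹)) * γ ^ 3 := by group
        _ = γ ^ 3 := by rw [hprod, one_mul]
    obtain ⟨h1, h2, h3⟩ := htw s hs s' hs' b hb b' hb' c hc c' hc' key
    subst h1; subst h2; subst h3
    exact ⟨rfl, rfl, rfl⟩

end Summit.MatrixMultiplication.MatrixMultiplication.Theorems.ThresholdSubsetTriples
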